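import Literature.MathematicalPhysics.QuantumFieldTheory.Balaban1983to89.Beta.TransportVertices
import Literature.MathematicalPhysics.QuantumFieldTheory.Balaban1983to89.Beta.SpinTable
import Literature.MathematicalPhysics.QuantumFieldTheory.Balaban1983to89.Beta.ColourTrace

/-!
# `Balaban1983to89.Beta.WilsonVertex` — THE ACTION-SIDE VERTICES OF THE WILSON PLAQUETTE: the exact `(W², B¹)` Taylor jet of
the class function `tr U(∂p)` in the parametrisation `U_b = e^{W_b} e^{B_b}` (fluctuation `W`, background `B`), BCH-free, for
words of ANY length in ANY normed algebra, with the kernel-checked TRACE NORMAL FORM «symmetric cubic + spin + transport»; the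
symmetric cubic cancels in Bałaban's complexified real part `tr U(∂p) + tr U(−∂p)`, the spin part IS `SpinTable.plaqPairs` (by
name), at a constant fluctuation field exactly ONE commutator `[W_μ, W_ν]` against `curl B` survives (the unit of spin coupling
`SpinTable` carried as a label, here DERIVED from the group product), `cubic` is one sixth of the third derivative of the transport
path of `Beta.TransportVertices` (by name: `holPath`, `D₁`, `D₂`, `quad`, `commSum`), and the colour trace of both vertices is the
adjoint-action matrix `ColourTrace.adMatC` (by name).  β sub-cell, row BETA-an3 gen 10, node BETA-an3-g10-WILSONVERTEX = the
(V-act) half of brick (V) of HOME/BETA/AN2.md §13.3 (the (V-con) half — constraint / averaging / `R_U` transport rows — and the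
contact kernels are `Beta.TransportVertices`' owner's); it serves the TABLE SIDE (D1-rep) of the wall's one-loop binder: «which
vertex of the ACTUAL plaquette action produces which sector of the leg table».

HONEST FRAMING (mandatory, page 1).  «discharging `BetaPertH` makes Bałaban's UV stability UNCONDITIONAL — a real
constructive-QFT result; it is NOT the continuum limit and NOT the Clay problem.»  Gloss 1 (the LEAD's, BETA-SPEC §0):
«unconditional» means the coupling-window HYPOTHESIS of [Balaban1989LargeFieldII] (B16) p. 355's one displayed END STATEMENT is
discharged INSIDE THE LATTICE RENORMALIZATION PROGRAMME; every other input remains a verbatim QUOTATION of Bałaban's printed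
theorems — the result is «B16's theorem with one hypothesis fewer», not a first-principles formalisation of B5–B16.  Gloss 2: the
object is the `EventualForm`-unconditional END statement, NOT «Theorem 2 as printed».  Gloss 3″ (binding): what is made
unconditional is an END STATEMENT under the explicit γ-smallness restrictions of the kernel binders — never «Theorem 2 as printed»,
never the continuum limit / mass gap / Clay.  THIS FILE discharges nothing of `BetaPertH`; it is one algebraic input of the table side.

ABSOLUTE RULE (cell charter, verbatim in substance).  No internally-minted statement enters as a cited fact: every hypothesis of every
theorem below is kernel-proved in this package; NOTHING is cited.  The manuscript under audit ([Balaban1985BackgroundPropagators] = B9)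
appears ONLY as CONTEXT — to say which printed display each derived identity is the algebraic skeleton of; no disputed step of B9 is
used, and programme-internal claims are never cited.

WHAT IS IN PRINT (context, cited by number).  T. Bałaban, *Propagators for lattice gauge theories in a background field*, Commun.
Math. Phys. 99 (1985) 389–434 [Balaban1985BackgroundPropagators]: p. 390 (3.1) `A^η(U′U₀) = Σ_p η^{d−4}[1 − Re tr(U′U₀)(∂p)]` with
`U′ = exp iηA` the fluctuation (LEFT factor) and `U₀` the background; (3.2)/(3.6) the second-order expansion of the plaquette variable
in the transported fields `A′(b)` with the ordered-pair commutator term `Σ_{b₁≺b₂} i[A′(b₁), A′(b₂)]` («≺ denotes a natural ordering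
among bonds of the oriented contour»; on the coefficient ½ see the NOTE in `Beta.TransportVertices`); p. 391 (3.5) `U(x,x′) =
U(x′,x)⁻¹`, `A(x,x′) = −A(x′,x)`; (3.7) the insertion defining the fine Hessian `Δ^η(U₀)`; «This expansion is valid also for
configurations A and U₀ with values respectively in the complexified algebra g^c and the group G^c, we have to interpret only
Re U₀(∂p) and Im U₀(∂p) as Re U₀(∂p) = ½(U₀(∂p) + U₀(−∂p)), Im U₀(∂p) = (1/2i)(U₀(∂p) − U₀(−∂p)).  Here −∂p is the contour ∂(−p),
and U₀(−∂p) = (U₀(∂p))⁻¹.»; p. 392 «Let us recall that the trace is normalized, i.e., tr 1 = 1»; (3.10) `Δ(U) = D*D + Δ′(U)` with the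
explicit spin term `tr Σ_{b₁<b₂⊂∂p} i[A′(b₁), A′(b₂)] η⁻² Im U(∂p)`.  Nothing of this is used below.

THE SETTING (definitions asserting nothing).  A TWO-SORTED WORD is a list of tagged letters `(true, x)` = a FLUCTUATION letter `e^x`
(«W-letter») or `(false, y)` = a BACKGROUND letter `e^y` («B-letter»); the plaquette `U(∂p_{μν}(x)) = U_μ(x)U_ν(x+e_μ)U_μ(x+e_ν)⁻¹U_ν(x)⁻¹`
with `U_b = e^{W_b}e^{B_b}` is the eight-letter word `plaq W₁ W₂ W₃ W₄ B₁ B₂ B₃ B₄ = e^{W₁}e^{B₁}e^{W₂}e^{B₂}e^{−B₃}e^{−W₃}e^{−B₄}e^{−W₄}`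
(§4).  The ordered product of the exponential jets has the graded components `P11` (one W, one B), `P21 𝕜` (two W, one B),
`P12 𝕜` (one W, two B) (§2, explicit recursions over the word), and `cubic 𝕜 l = Σ_{i<j<k} b_ib_jb_k + ½Σ_{i<j}(b_i²b_j + b_ib_j²) + ⅙Σ_i b_i³`
is the full third-order term of `Π_j e^{b_j}` (§5).  `twistAux β L = Σ_i [β_i, x_i]` (TRANSPORT sum: each W-letter commuted with the
background `β_i` accumulated before it along the contour), `inv L` = the inverse word (reversed, negated).

WHAT THIS FILE PROVES (every ring-level statement for an arbitrary `NormedRing`/`NormedAlgebra 𝕜`, `𝕜 = ℝ` or `ℂ`; traces are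
arbitrary linear `τ : 𝔸 →ₗ[𝕜] V` with `τ(ab) = τ(ba)` — no adjoint, no positivity, no finite dimension).
* §1 LETTER CALCULUS: `wpart`/`bpart`/`inv` bookkeeping, `twistAux_append`, `twistAux_eq` (shift of the initial background),
  `twistAux_inv : twist(inv L) = [Σ_B, Σ_W] − twist L`, `commSum_append'`, `commSum_reverse_map_neg : commSum(inv) = −commSum`.
* §2 POLARISATION: `quad_map_scale`, `cubic_map_scale : cubic(σW, τB) = σ³·cubic W + σ²τ·P21 + στ²·P12 + τ³·cubic B` — the graded
  components ARE the two-variable Taylor coefficients of the ordered product along the ray `(σW, τB)` (no `MvPolynomial`, no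
  commutativity needed) — and `P21_eq_rays` (extraction of `P21` from two rays).
* §3 THE GRADED THIRD-ORDER TRACE FORMULA `two_smul_trace_P21` / `trace_P21`:
  `τ(P21 L) = ½τ(Z_W² Z_B) + ½τ(Z_B · commSum(wpart L)) + τ(Z_W · twist L)` — SYMMETRIC CUBIC + SPIN + TRANSPORT (`Z_W`, `Z_B` the
  letter sums), by induction on the word from `P11_eq : P11 L = Z_W Z_B + twist L` and `TransportVertices.two_smul_quad`; and
  `trace_P21_add_trace_P21_inv`: **in `τ(P21 L) + τ(P21 (inv L))` the symmetric cubic CANCELS** — word plus inverse word is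
  `τ(Z_B · commSum) + 2τ(Z_W · twist)`, pure spin + transport.
* §4 THE PLAQUETTE: `wpart_plaq = [W₁, W₂, −W₃, −W₄]` (sum = lattice curl, `sum_four_signed`), `inv_plaq` (inverse word = reversed
  orientation, B9 (3.5)), `twist_plaq` (the three transport commutators `[B₁,W₂] − [B₁+B₂−B₃, W₃] − [B₁+B₂−B₃−B₄, W₄]`),
  `commSum_wpart_plaq : commSum [W₁, W₂, −W₃, −W₄] = SpinTable.plaqPairs W₁ W₄ W₃ W₂` (LINK BY NAME to `SpinTable` §6),
  `trace_P21_plaq` (the `(2,1)`-jet of `tr U(∂p)`), `trace_P21_plaq_add_rev` (the `(2,1)`-jet of `tr U(∂p) + tr U(−∂p)`: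
  `τ(curl B · plaqPairs) + 2τ(curl W · twist)`), and `trace_P21_plaq_add_rev_const`: at a CONSTANT fluctuation field
  (`W₁ = W₃ = X`, `W₂ = W₄ = Y`) the transport term vanishes with the curl and the jet is `2·τ(curl B · (XY − YX))` — in
  `Re tr U(∂p) = ½(…)` exactly ONE commutator `[W_μ, W_ν]` against the background plaquette field, coefficient ONE
  (`SpinTable.plaqPairs_local`), the spin-coupling unit.
* §5 IDENTIFICATION WITH THE TRANSPORT PATH (`[CompleteSpace 𝔸]`): `D₃` and `hasDerivAt_D₂ : HasDerivAt (D₂ l) (D₃ l t) t`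
  (continuing `TransportVertices.hasDerivAt_D₁`), `D₃_zero : D₃ l 0 = 6·cubic l`, `hasDerivAt_D₂_zero` — so `cubic`, and with §2
  `P21`, `P12`, are the honest third-order Taylor data of `t ↦ Π_j exp(t b_j)`, not a definition chosen to make §3 true.
* §6 COLOUR (`Matrix (Fin N) (Fin N) ℂ`, `N ≠ 0`): `trace_gen_bracket : Tr(iτ_a·[iτ_b, iτ_c]) = −N · adMatC τ (τ_b) a c` — the colour
  tensor of the transport term (`b` = accumulated background) and of the spin term (`a` = curl B) is `ColourTrace`'s adjoint-action
  matrix, whose generator trace form `−2N²δ` (`ColourTrace.trace_adMatC_gen`) is what `GhostTable`/`SpinTable` consume.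

DICTIONARY / LABELLED (context only, asserted nowhere below).  `W_b ↔ iηA(b)` (B9's `U′ = exp iηA`), `e^{B_b} ↔ U₀(b)` for a
background in the exponential chart, `τ ↔` the normalized trace `tr` (p. 392) or `Matrix.trace`; the `B`-degree-one jet is the first
variation of the plaquette action in the background at `U₀ = 1` along `t ↦ e^{tB}` — the three-leg vertex (two fluctuation legs, one
background leg) whose bubble is the one-loop leg table; `curl W ↔ η²(D^η A)(p)` at `U₀ = 1` (B9 p. 391), `twist ↔` the `U₀`-linear
part of the parallel transports `R(U₀(x,·))` in (3.4), `plaqPairs ↔ Σ_{b₁≺b₂}[A′(b₁), A′(b₂)]` of (3.6)/(3.10).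

HOW IT IS MEANT TO BE USED (remark).  Row (D1-rep) asks which vertex of the ACTUAL Wilson action produces which coefficient of the
realised leg table (`SquareTable` §5: `(8N², −2N²)`; `SpinTable`: square sector = spin vertex alone iff `s² = 4`, cell sector = four
vector copies against one ghost).  This file supplies the action side of that sentence at the level of exact algebra: per plaquette and
per ordered pair of fluctuation letters the real part of the Wilson class function contains the spin structure `plaqPairs` with
coefficient ½·(letter normalisation) and NO symmetric-cubic contamination, plus a transport term that is `curl W` times background
commutators (a gauge-covariantisation of `(curl W)²`, vanishing at constant `W`, of higher table degree in the sense of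
`SpinTable.plaqPairs_expand`).  Typing these as lattice operators (`BubbleTable.stencilIns`, `SpinTable.spinVertex`) with the
factors `iη`, `η^{d−4}`, the sum over plaquettes and orientations `(μ,ν)`, and the resulting value of the spin coupling `s`, is the
SUCCESSOR node (S-next) and is NOT done here; nor are: the `(2,2)` contact jet `P22` (the `W²B²` plaquette vertex), the (V-con)
constraint / averaging / `R_U` rows and the contact kernels `K″` (brick (V) of AN2.md §13.3, its owner's), (T-def), any bound (the
remainder bounds live in `Beta.TransportVertices` §1–§2 and apply to these words verbatim: a plaquette is a contour of 8 letters), and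
anything about `BetaPertH`.

Version v1.0 (gen 10).  GAPS record C-beta-an3-21.  All tags [folklore]: finite algebra and one-variable calculus in a Banach algebra.
-/

noncomputable section

namespace Literature.MathematicalPhysics.QuantumFieldTheory.Balaban1983to89.Beta.WilsonVertex

open NormedSpace
open Literature.MathematicalPhysics.QuantumFieldTheory.Balaban1983to89.Beta.TransportVertices

/-! ## §1 Two-sorted letters: fluctuation (`true`, «W-letters») and background (`false`, «B-letters») -/

section Letters

variable {𝔸 : Type*}

/-- the W-letters (fluctuation letters, tag `true`) of a two-sorted word, in order. [folklore] -/
def wpart : List (Bool × 𝔸) → List 𝔸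
  | [] => []
  | (true, x) :: L => x :: wpart L
  | (false, _) :: L => wpart L

/-- the B-letters (background letters, tag `false`) of a two-sorted word, in order. [folklore] -/
def bpart : List (Bool × 𝔸) → List 𝔸
  | [] => []
  | (true, _) :: L => bpart L
  | (false, y) :: L => y :: bpart L

/-- `wpart` of the empty word. [folklore] -/
@[simp] theorem wpart_nil : wpart ([] : List (Bool × 𝔸)) = [] := rfl
/-- `wpart` of a word starting with a W-letter. [folklore] -/
@[simp] theorem wpart_consW (x : 𝔸) (L : List (Bool × 𝔸)) : wpart ((true, x) :: L) = x :: wpart L := rfl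
/-- `wpart` of a word starting with a B-letter. [folklore] -/
@[simp] theorem wpart_consB (y : 𝔸) (L : List (Bool × 𝔸)) : wpart ((false, y) :: L) = wpart L := rfl
/-- `bpart` of the empty word. [folklore] -/
@[simp] theorem bpart_nil : bpart ([] : List (Bool × 𝔸)) = [] := rfl
/-- `bpart` of a word starting with a W-letter. [folklore] -/
@[simp] theorem bpart_consW (x : 𝔸) (L : List (Bool × 𝔸)) : bpart ((true, x) :: L) = bpart L := rfl
/-- `bpart` of a word starting with a B-letter. [folklore] -/
@[simp] theorem bpart_consB (y : 𝔸) (L : List (Bool × 𝔸)) : bpart ((false, y) :: L) = y :: bpart L := rfl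

/-- `wpart` is additive over concatenation. [folklore] -/
@[simp] theorem wpart_append (L M : List (Bool × 𝔸)) : wpart (L ++ M) = wpart L ++ wpart M := by
  induction L with
  | nil => rfl
  | cons p L ih =>
    obtain ⟨t, z⟩ := p
    cases t <;> simp [ih]

/-- `bpart` is additive over concatenation. [folklore] -/
@[simp] theorem bpart_append (L M : List (Bool × 𝔸)) : bpart (L ++ M) = bpart L ++ bpart M := by
  induction L with
  | nil => rfl
  | cons p L ih =>
    obtain ⟨t, z⟩ := p
    cases t <;> simp [ih]

variable [Ring 𝔸]

/-- THE INVERSE WORD: the letters of `U(∂p)⁻¹ = U(−∂p)` — reversed order, negated letters, sorts kept. [folklore] -/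
def inv (L : List (Bool × 𝔸)) : List (Bool × 𝔸) := L.reverse.map fun p => (p.1, -p.2)

/-- the inverse of the empty word. [folklore] -/
@[simp] theorem inv_nil : inv ([] : List (Bool × 𝔸)) = [] := rfl

/-- the inverse of a word with a first letter: that letter, negated, goes last. [folklore] -/
theorem inv_cons (p : Bool × 𝔸) (L : List (Bool × 𝔸)) : inv (p :: L) = inv L ++ [(p.1, -p.2)] := by
  simp [inv]

/-- the W-letters of the inverse word: reversed and negated. [folklore] -/
@[simp] theorem wpart_inv (L : List (Bool × 𝔸)) : wpart (inv L) = (wpart L).reverse.map Neg.neg := by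
  induction L with
  | nil => rfl
  | cons p L ih =>
    obtain ⟨t, z⟩ := p
    cases t <;> simp [inv_cons, ih]

/-- the B-letters of the inverse word: reversed and negated. [folklore] -/
@[simp] theorem bpart_inv (L : List (Bool × 𝔸)) : bpart (inv L) = (bpart L).reverse.map Neg.neg := by
  induction L with
  | nil => rfl
  | cons p L ih =>
    obtain ⟨t, z⟩ := p
    cases t <;> simp [inv_cons, ih]

/-- `Σ (−l_j)` over the reversed list is `−Σ l_j`. [folklore] -/
@[simp] theorem sum_reverse_map_neg (l : List 𝔸) : (l.reverse.map Neg.neg).sum = -l.sum := by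
  induction l with
  | nil => simp
  | cons b l ih =>
    rw [List.reverse_cons, List.map_append, List.sum_append, ih, List.map_singleton, List.sum_singleton,
      List.sum_cons]
    abel

/-- THE TWIST SUM with accumulator `β` (the background already traversed): each W-letter `x` contributes the commutator
`[β + (B-letters preceding x), x]`; `twistAux 0 L = Σ_i [β_i, x_i]`, `β_i` = sum of the B-letters preceding the `i`-th
W-letter of the word. [folklore] -/
def twistAux : 𝔸 → List (Bool × 𝔸) → 𝔸
  | _, [] => 0
  | β, (true, x) :: L => (β * x - x * β) + twistAux β L
  | β, (false, y) :: L => twistAux (β + y) L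

/-- the transport sum of the empty word. [folklore] -/
@[simp] theorem twistAux_nil (β : 𝔸) : twistAux β ([] : List (Bool × 𝔸)) = 0 := rfl
/-- transport sum, W-letter first: that letter is commuted with the background accumulated so far. [folklore] -/
@[simp] theorem twistAux_consW (β x : 𝔸) (L : List (Bool × 𝔸)) :
    twistAux β ((true, x) :: L) = (β * x - x * β) + twistAux β L := rfl
/-- transport sum, B-letter first: the letter joins the accumulated background. [folklore] -/
@[simp] theorem twistAux_consB (β y : 𝔸) (L : List (Bool × 𝔸)) :
    twistAux β ((false, y) :: L) = twistAux (β + y) L := rfl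

/-- Shifting the accumulator: `twistAux β L = twistAux 0 L + [β, Σ wpart L]`. [folklore] -/
theorem twistAux_eq (β : 𝔸) (L : List (Bool × 𝔸)) :
    twistAux β L = twistAux 0 L + (β * (wpart L).sum - (wpart L).sum * β) := by
  induction L generalizing β with
  | nil => simp
  | cons p L ih =>
    obtain ⟨t, z⟩ := p
    cases t
    · rw [twistAux_consB, twistAux_consB, ih (β + z), ih (0 + z), wpart_consB]
      noncomm_ring
    · rw [twistAux_consW, twistAux_consW, ih β, wpart_consW, List.sum_cons]
      noncomm_ring

/-- `twistAux` over a concatenation. [folklore] -/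
theorem twistAux_append (β : 𝔸) (L M : List (Bool × 𝔸)) :
    twistAux β (L ++ M) = twistAux β L + twistAux (β + (bpart L).sum) M := by
  induction L generalizing β with
  | nil => simp
  | cons p L ih =>
    obtain ⟨t, z⟩ := p
    cases t
    · rw [List.cons_append, twistAux_consB, twistAux_consB, ih, bpart_consB, List.sum_cons, add_assoc]
    · rw [List.cons_append, twistAux_consW, twistAux_consW, ih, bpart_consW, add_assoc]

/-- THE TWIST OF THE INVERSE WORD: `twist (inv L) = [Σ bpart L, Σ wpart L] − twist L`. [folklore] -/
theorem twistAux_inv (L : List (Bool × 𝔸)) :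
    twistAux 0 (inv L) =
      ((bpart L).sum * (wpart L).sum - (wpart L).sum * (bpart L).sum) - twistAux 0 L := by
  induction L with
  | nil => simp
  | cons p L ih =>
    obtain ⟨t, z⟩ := p
    cases t
    · rw [inv_cons, twistAux_append, ih]
      simp only [twistAux_nil, twistAux_consB, bpart_consB, wpart_consB, List.sum_cons, add_zero]
      rw [twistAux_eq (0 + z) L]
      noncomm_ring
    · rw [inv_cons, twistAux_append, ih]
      simp only [twistAux_consW, twistAux_nil, wpart_consW, bpart_consW, List.sum_cons, bpart_inv,
        sum_reverse_map_neg, add_zero]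
      noncomm_ring

/-- `commSum` over a concatenation. [folklore] -/
theorem commSum_append' {𝔸 : Type*} [NormedRing 𝔸] (l m : List 𝔸) :
    commSum (l ++ m) = commSum l + commSum m + (l.sum * m.sum - m.sum * l.sum) := by
  induction l with
  | nil => simp
  | cons b l ih =>
    rw [List.cons_append, commSum_cons, commSum_cons, ih, List.sum_append, List.sum_cons]
    noncomm_ring

/-- THE ORDERED COMMUTATOR SUM OF THE INVERSE WORD is minus that of the word (the two negations cancel, the reversal
flips every ordered pair). [folklore] -/
theorem commSum_reverse_map_neg {𝔸 : Type*} [NormedRing 𝔸] (l : List 𝔸) :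
    commSum (l.reverse.map Neg.neg) = -commSum l := by
  induction l with
  | nil => simp
  | cons b l ih =>
    rw [List.reverse_cons, List.map_append, commSum_append', ih, List.map_singleton, commSum_cons,
      sum_reverse_map_neg]
    simp only [commSum_cons, commSum_nil, List.sum_cons, List.sum_nil]
    noncomm_ring

end Letters

/-! ## §2 Graded components of an ordered product of exponential jets -/

section Graded

variable (𝕜 : Type*) [RCLike 𝕜] {𝔸 : Type*} [NormedRing 𝔸] [NormedAlgebra 𝕜 𝔸]

/-- THE THIRD-ORDER TERM of the ordered product `Π_j (1 + b_j + b_j²/2 + b_j³/6 + ⋯)`: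
`cubic [b₁,…,b_n] = Σ_{i<j<k} b_ib_jb_k + ½Σ_{i<j}(b_i²b_j + b_ib_j²) + ⅙Σ_j b_j³`, recursively
`cubic (b :: l) = cubic l + b·quad l + ½b²·Σl + ⅙b³` (`quad` = the second-order term of `Beta.TransportVertices`). [folklore] -/
def cubic : List 𝔸 → 𝔸
  | [] => 0
  | b :: l => cubic l + b * quad 𝕜 l + (2 : 𝕜)⁻¹ • (b * b) * l.sum + (6 : 𝕜)⁻¹ • (b * b * b)

/-- `cubic` of the empty list. [folklore] -/
@[simp] theorem cubic_nil : cubic 𝕜 ([] : List 𝔸) = 0 := rfl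
/-- `cubic` recursion: `cubic (b :: l) = cubic l + b·quad l + ½b²·Σl + ⅙b³`. [folklore] -/
@[simp] theorem cubic_cons (b : 𝔸) (l : List 𝔸) :
    cubic 𝕜 (b :: l) = cubic 𝕜 l + b * quad 𝕜 l + (2 : 𝕜)⁻¹ • (b * b) * l.sum + (6 : 𝕜)⁻¹ • (b * b * b) := rfl

/-- THE `(1,1)`-COMPONENT (one W-letter, one B-letter) of the ordered product of exponential jets of a two-sorted word:
`P11 L = Σ_{i<j, sorts differ} z_iz_j`. [folklore] -/
def P11 : List (Bool × 𝔸) → 𝔸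
  | [] => 0
  | (true, x) :: L => P11 L + x * (bpart L).sum
  | (false, y) :: L => P11 L + y * (wpart L).sum

/-- `P11` of the empty word. [folklore] -/
@[simp] theorem P11_nil : P11 ([] : List (Bool × 𝔸)) = 0 := rfl
/-- `P11` recursion, W-letter first. [folklore] -/
@[simp] theorem P11_consW (x : 𝔸) (L : List (Bool × 𝔸)) : P11 ((true, x) :: L) = P11 L + x * (bpart L).sum := rfl
/-- `P11` recursion, B-letter first. [folklore] -/
@[simp] theorem P11_consB (y : 𝔸) (L : List (Bool × 𝔸)) : P11 ((false, y) :: L) = P11 L + y * (wpart L).sum := rfl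

/-- THE `(2,1)`-COMPONENT (W-degree two, B-degree one) of the ordered product of exponential jets — THE OBJECT OF THIS
FILE: recursively `P21 ((W,x) :: L) = P21 L + x·P11 L + ½x²·Σ bpart L`, `P21 ((B,y) :: L) = P21 L + y·quad (wpart L)`.
[folklore] -/
def P21 : List (Bool × 𝔸) → 𝔸
  | [] => 0
  | (true, x) :: L => P21 L + x * P11 L + (2 : 𝕜)⁻¹ • (x * x) * (bpart L).sum
  | (false, y) :: L => P21 L + y * quad 𝕜 (wpart L)

/-- `P21` of the empty word. [folklore] -/
@[simp] theorem P21_nil : P21 𝕜 ([] : List (Bool × 𝔸)) = 0 := rfl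
/-- `P21` recursion, W-letter first: `+ x·P11 L + ½x²·Σ_B`. [folklore] -/
@[simp] theorem P21_consW (x : 𝔸) (L : List (Bool × 𝔸)) :
    P21 𝕜 ((true, x) :: L) = P21 𝕜 L + x * P11 L + (2 : 𝕜)⁻¹ • (x * x) * (bpart L).sum := rfl
/-- `P21` recursion, B-letter first: `+ y·quad(wpart L)`. [folklore] -/
@[simp] theorem P21_consB (y : 𝔸) (L : List (Bool × 𝔸)) :
    P21 𝕜 ((false, y) :: L) = P21 𝕜 L + y * quad 𝕜 (wpart L) := rfl

/-- THE `(1,2)`-COMPONENT (W-degree one, B-degree two), the mirror image of `P21`. [folklore] -/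
def P12 : List (Bool × 𝔸) → 𝔸
  | [] => 0
  | (true, x) :: L => P12 L + x * quad 𝕜 (bpart L)
  | (false, y) :: L => P12 L + y * P11 L + (2 : 𝕜)⁻¹ • (y * y) * (wpart L).sum

/-- `P12` of the empty word. [folklore] -/
@[simp] theorem P12_nil : P12 𝕜 ([] : List (Bool × 𝔸)) = 0 := rfl
/-- `P12` recursion, W-letter first: `+ x·quad(bpart L)`. [folklore] -/
@[simp] theorem P12_consW (x : 𝔸) (L : List (Bool × 𝔸)) :
    P12 𝕜 ((true, x) :: L) = P12 𝕜 L + x * quad 𝕜 (bpart L) := rfl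
/-- `P12` recursion, B-letter first: `+ y·P11 L + ½y²·Σ_W`. [folklore] -/
@[simp] theorem P12_consB (y : 𝔸) (L : List (Bool × 𝔸)) :
    P12 𝕜 ((false, y) :: L) = P12 𝕜 L + y * P11 L + (2 : 𝕜)⁻¹ • (y * y) * (wpart L).sum := rfl

/-- THE TWO-PARAMETER SCALING of a two-sorted word: W-letters by `σ`, B-letters by `τ`. [folklore] -/
def scale (σ τ : 𝕜) : Bool × 𝔸 → 𝔸
  | (true, x) => σ • x
  | (false, y) => τ • y

/-- `scale σ τ` multiplies a W-letter by `σ`. [folklore] -/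
@[simp] theorem scale_W (σ τ : 𝕜) (x : 𝔸) : scale 𝕜 σ τ (true, x) = σ • x := rfl
/-- `scale σ τ` multiplies a B-letter by `τ`. [folklore] -/
@[simp] theorem scale_B (σ τ : 𝕜) (y : 𝔸) : scale 𝕜 σ τ (false, y) = τ • y := rfl

/-- degree one: `Σ scaled letters = σ·Σ wpart + τ·Σ bpart`. [folklore] -/
theorem sum_map_scale (σ τ : 𝕜) (L : List (Bool × 𝔸)) :
    (L.map (scale 𝕜 σ τ)).sum = σ • (wpart L).sum + τ • (bpart L).sum := by
  induction L with
  | nil => simp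
  | cons p L ih =>
    obtain ⟨t, z⟩ := p
    cases t
    · simp only [List.map_cons, scale_B, List.sum_cons, ih, wpart_consB, bpart_consB, smul_add]
      abel
    · simp only [List.map_cons, scale_W, List.sum_cons, ih, wpart_consW, bpart_consW, smul_add]
      abel

/-- degree two, POLARISED: `quad (scaled word) = σ²·quad (wpart) + στ·P11 + τ²·quad (bpart)` — `P11` IS the bidegree-`(1,1)`
Taylor coefficient of the second-order term. [folklore] -/
theorem quad_map_scale (σ τ : 𝕜) (L : List (Bool × 𝔸)) :
    quad 𝕜 (L.map (scale 𝕜 σ τ)) = σ ^ 2 • quad 𝕜 (wpart L) + (σ * τ) • P11 L + τ ^ 2 • quad 𝕜 (bpart L) := by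
  induction L with
  | nil => simp
  | cons p L ih =>
    obtain ⟨t, z⟩ := p
    cases t
    · simp only [List.map_cons, scale_B, quad_cons, ih, sum_map_scale, wpart_consB, bpart_consB, P11_consB,
        smul_add, mul_add, smul_mul_assoc, mul_smul_comm, smul_smul, pow_two]
      module
    · simp only [List.map_cons, scale_W, quad_cons, ih, sum_map_scale, wpart_consW, bpart_consW, P11_consW,
        smul_add, mul_add, smul_mul_assoc, mul_smul_comm, smul_smul, pow_two]
      module

/-- degree three, POLARISED: `cubic (scaled word) = σ³·cubic (wpart) + σ²τ·P21 + στ²·P12 + τ³·cubic (bpart)` — `P21` IS the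
bidegree-`(2,1)` Taylor coefficient of the third-order term of the ordered product of exponential jets, `P12` the `(1,2)` one.
[folklore] -/
theorem cubic_map_scale (σ τ : 𝕜) (L : List (Bool × 𝔸)) :
    cubic 𝕜 (L.map (scale 𝕜 σ τ)) =
      σ ^ 3 • cubic 𝕜 (wpart L) + (σ ^ 2 * τ) • P21 𝕜 L + (σ * τ ^ 2) • P12 𝕜 L + τ ^ 3 • cubic 𝕜 (bpart L) := by
  induction L with
  | nil => simp
  | cons p L ih =>
    obtain ⟨t, z⟩ := p
    cases t
    · simp only [List.map_cons, scale_B, cubic_cons, ih, quad_map_scale, sum_map_scale, wpart_consB, bpart_consB,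
        P21_consB, P12_consB, smul_add, mul_add, smul_mul_assoc, mul_smul_comm, smul_smul, pow_succ, pow_zero,
        one_mul, mul_assoc]
      module
    · simp only [List.map_cons, scale_W, cubic_cons, ih, quad_map_scale, sum_map_scale, wpart_consW, bpart_consW,
        P21_consW, P12_consW, smul_add, mul_add, smul_mul_assoc, mul_smul_comm, smul_smul, pow_succ, pow_zero,
        one_mul, mul_assoc]
      module

/-- EXTRACTION: the `(2,1)`-component from three rays — `P21 = ½(cubic(W+B) − cubic(W−B)) − cubic(B)`. [folklore] -/
theorem P21_eq_rays (L : List (Bool × 𝔸)) :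
    P21 𝕜 L = (2 : 𝕜)⁻¹ • (cubic 𝕜 (L.map (scale 𝕜 1 1)) - cubic 𝕜 (L.map (scale 𝕜 1 (-1))))
      - cubic 𝕜 (bpart L) := by
  rw [cubic_map_scale, cubic_map_scale]
  module

end Graded

/-! ## §3 THE GRADED THIRD-ORDER TRACE FORMULA (transport + spin + symmetric cubic) -/

section Trace

variable (𝕜 : Type*) [RCLike 𝕜] {𝔸 : Type*} [NormedRing 𝔸] [NormedAlgebra 𝕜 𝔸]
variable {V : Type*} [AddCommGroup V] [Module 𝕜 V]

/-- THE `(1,1)`-COMPONENT IN CLOSED FORM (a ring identity, no trace): `P11 L = (Σ wpart L)(Σ bpart L) + Σ_i [β_i, x_i]` —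
every mixed ordered pair is either `x·y` (W before B: a term of the product of the sums) or `y·x = x·y + [y,x]`. [folklore] -/
theorem P11_eq (L : List (Bool × 𝔸)) : P11 L = (wpart L).sum * (bpart L).sum + twistAux 0 L := by
  induction L with
  | nil => simp
  | cons p L ih =>
    obtain ⟨t, z⟩ := p
    cases t
    · rw [P11_consB, ih, wpart_consB, bpart_consB, List.sum_cons, twistAux_consB, twistAux_eq (0 + z) L]
      noncomm_ring
    · rw [P11_consW, ih, wpart_consW, bpart_consW, List.sum_cons, twistAux_consW]
      noncomm_ring

/-- **THE GRADED THIRD-ORDER TRACE FORMULA.**  For every two-sorted word `L` and every TRACIAL linear functional `τ`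
(`τ(ab) = τ(ba)`): twice the trace of the `(2,1)`-component of the ordered product of exponential jets is
`τ(Z_W² Z_B) + τ(Z_B · Σ_{i<j}[x_i,x_j]) + 2·τ(Z_W · Σ_i[β_i, x_i])` — SYMMETRIC CUBIC + SPIN + TRANSPORT — where
`Z_W = Σ wpart L`, `Z_B = Σ bpart L`, the `x_i` are the W-letters in order and `β_i` is the sum of the B-letters preceding `x_i`.
(Proof: induction on the word; the W-step is the closed form of `P11`, the B-step is `2·quad = Z² + commSum` of
`Beta.TransportVertices`; traciality moves letters cyclically.) [folklore] -/
theorem two_smul_trace_P21 (τ : 𝔸 →ₗ[𝕜] V) (hτ : ∀ a b : 𝔸, τ (a * b) = τ (b * a)) (L : List (Bool × 𝔸)) :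
    (2 : 𝕜) • τ (P21 𝕜 L) =
      τ ((wpart L).sum * ((wpart L).sum * (bpart L).sum)) + τ ((bpart L).sum * commSum (wpart L))
        + (2 : 𝕜) • τ ((wpart L).sum * twistAux 0 L) := by
  induction L with
  | nil => simp
  | cons p L ih =>
    obtain ⟨t, z⟩ := p
    cases t
    · -- a background letter `z = y`
      have hq : (2 : 𝕜) • τ (z * quad 𝕜 (wpart L)) =
          τ (z * ((wpart L).sum * (wpart L).sum)) + τ (z * commSum (wpart L)) := by
        rw [← map_smul, ← mul_smul_comm, two_smul_quad, mul_add, map_add]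
      have h1 : τ ((wpart L).sum * (z * (wpart L).sum)) = τ (z * ((wpart L).sum * (wpart L).sum)) := by
        rw [hτ (wpart L).sum (z * (wpart L).sum), mul_assoc]
      have h2 : τ ((wpart L).sum * ((wpart L).sum * z)) = τ (z * ((wpart L).sum * (wpart L).sum)) := by
        rw [← mul_assoc, hτ ((wpart L).sum * (wpart L).sum) z]
      have ht : twistAux 0 ((false, z) :: L) = twistAux 0 L + (z * (wpart L).sum - (wpart L).sum * z) := by
        rw [twistAux_consB, twistAux_eq (0 + z) L, zero_add]
      rw [P21_consB, wpart_consB, bpart_consB, List.sum_cons, ht, map_add, smul_add, ih, hq]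
      simp only [map_add, map_sub, mul_add, add_mul, mul_sub, h1, h2, smul_add, smul_sub]
      module
    · -- a fluctuation letter `z = x`
      have hh : (2 : 𝕜) • τ ((2 : 𝕜)⁻¹ • (z * z) * (bpart L).sum) = τ (z * (z * (bpart L).sum)) := by
        rw [smul_mul_assoc, map_smul, smul_smul, mul_inv_cancel₀ (two_ne_zero' 𝕜), one_smul, mul_assoc]
      have h1 : τ ((bpart L).sum * (z * (wpart L).sum)) = τ (z * ((wpart L).sum * (bpart L).sum)) := by
        rw [hτ (bpart L).sum (z * (wpart L).sum), mul_assoc]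
      have h2 : τ ((bpart L).sum * ((wpart L).sum * z)) = τ ((wpart L).sum * (z * (bpart L).sum)) := by
        rw [hτ (bpart L).sum ((wpart L).sum * z), mul_assoc]
      have ht : twistAux 0 ((true, z) :: L) = twistAux 0 L := by
        rw [twistAux_consW, zero_mul, mul_zero, sub_zero, zero_add]
      rw [P21_consW, P11_eq, wpart_consW, bpart_consW, List.sum_cons, ht, commSum_cons, map_add, map_add, smul_add,
        smul_add, ih, hh]
      simp only [map_add, map_sub, mul_add, add_mul, mul_sub, h1, h2, smul_add]
      module

/-- … the same with the factor `½` on the other side. [folklore] -/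
theorem trace_P21 (τ : 𝔸 →ₗ[𝕜] V) (hτ : ∀ a b : 𝔸, τ (a * b) = τ (b * a)) (L : List (Bool × 𝔸)) :
    τ (P21 𝕜 L) =
      (2 : 𝕜)⁻¹ • τ ((wpart L).sum * ((wpart L).sum * (bpart L).sum))
        + (2 : 𝕜)⁻¹ • τ ((bpart L).sum * commSum (wpart L)) + τ ((wpart L).sum * twistAux 0 L) := by
  have h := two_smul_trace_P21 𝕜 τ hτ L
  have h2 : τ (P21 𝕜 L) = (2 : 𝕜)⁻¹ • ((2 : 𝕜) • τ (P21 𝕜 L)) := by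
    rw [smul_smul, inv_mul_cancel₀ (two_ne_zero' 𝕜), one_smul]
  rw [h2, h, smul_add, smul_add, smul_smul, inv_mul_cancel₀ (two_ne_zero' 𝕜), one_smul]

/-- **THE REAL PART KILLS THE SYMMETRIC CUBIC.**  With Bałaban's complexified definition
`Re U(∂p) = ½(U(∂p) + U(−∂p))`, `U(−∂p) = U(∂p)⁻¹` ([Balaban1985BackgroundPropagators] p. 391), the `(2,1)`-component of
`tr U(∂p) + tr U(∂p)⁻¹` — word plus INVERSE WORD — is PURE SPIN + TRANSPORT:
`τ(P21 L) + τ(P21 (inv L)) = τ(Z_B · Σ_{i<j}[x_i,x_j]) + 2·τ(Z_W · Σ_i[β_i,x_i])`.  A ring-level statement: no adjoint,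
no positivity, any tracial `τ`. [folklore] -/
theorem trace_P21_add_trace_P21_inv (τ : 𝔸 →ₗ[𝕜] V) (hτ : ∀ a b : 𝔸, τ (a * b) = τ (b * a))
    (L : List (Bool × 𝔸)) :
    τ (P21 𝕜 L) + τ (P21 𝕜 (inv L)) =
      τ ((bpart L).sum * commSum (wpart L)) + (2 : 𝕜) • τ ((wpart L).sum * twistAux 0 L) := by
  have hL := two_smul_trace_P21 𝕜 τ hτ L
  have hI := two_smul_trace_P21 𝕜 τ hτ (inv L)
  rw [wpart_inv, bpart_inv, sum_reverse_map_neg, sum_reverse_map_neg, commSum_reverse_map_neg, twistAux_inv] at hI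
  have hc : τ ((wpart L).sum * ((bpart L).sum * (wpart L).sum)) = τ ((wpart L).sum * ((wpart L).sum * (bpart L).sum)) := by
    rw [← mul_assoc, hτ]
  have h2 : τ (P21 𝕜 L) + τ (P21 𝕜 (inv L)) =
      (2 : 𝕜)⁻¹ • ((2 : 𝕜) • τ (P21 𝕜 L) + (2 : 𝕜) • τ (P21 𝕜 (inv L))) := by
    rw [← smul_add, smul_smul, inv_mul_cancel₀ (two_ne_zero' 𝕜), one_smul]
  rw [h2, hL, hI]
  simp only [neg_mul, mul_neg, neg_neg, map_neg, map_sub, mul_sub, hc, smul_add, smul_sub, smul_neg]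
  module

end Trace

/-! ## §4 The Wilson plaquette word: (2,1)-jet of `tr U(∂p)` and of `Re tr U(∂p)` -/

section Plaquette

variable (𝕜 : Type*) [RCLike 𝕜] {𝔸 : Type*} [NormedRing 𝔸] [NormedAlgebra 𝕜 𝔸]
variable {V : Type*} [AddCommGroup V] [Module 𝕜 V]

/-- THE PLAQUETTE WORD of `U(∂p_{μν}(x)) = U_μ(x)·U_ν(x+e_μ)·U_μ(x+e_ν)⁻¹·U_ν(x)⁻¹` in the parametrisation
`U_b = e^{W_b}·e^{B_b}` ([Balaban1985BackgroundPropagators] (3.1) p. 390: `U = U′U₀`, `U′ = exp iηA` the fluctuation — the LEFT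
factor — and `U₀` the background; (3.5): `U(x,x′) = U(x′,x)⁻¹`): the eight letters
`e^{W₁}e^{B₁}·e^{W₂}e^{B₂}·e^{−B₃}e^{−W₃}·e^{−B₄}e^{−W₄}`, `W₁ = W_μ(x)`, `W₂ = W_ν(x+e_μ)`, `W₃ = W_μ(x+e_ν)`, `W₄ = W_ν(x)`
(`B` likewise).  A definition asserting nothing. [folklore] -/
def plaq (W₁ W₂ W₃ W₄ B₁ B₂ B₃ B₄ : 𝔸) : List (Bool × 𝔸) :=
  [(true, W₁), (false, B₁), (true, W₂), (false, B₂), (false, -B₃), (true, -W₃), (false, -B₄), (true, -W₄)]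

variable (W₁ W₂ W₃ W₄ B₁ B₂ B₃ B₄ : 𝔸)

omit [NormedAlgebra 𝕜 𝔸] in
/-- the W-letters of the plaquette word: `[W₁, W₂, −W₃, −W₄]`. [folklore] -/
theorem wpart_plaq : wpart (plaq W₁ W₂ W₃ W₄ B₁ B₂ B₃ B₄) = [W₁, W₂, -W₃, -W₄] := rfl

omit [NormedAlgebra 𝕜 𝔸] in
/-- the B-letters of the plaquette word: `[B₁, B₂, −B₃, −B₄]`. [folklore] -/
theorem bpart_plaq : bpart (plaq W₁ W₂ W₃ W₄ B₁ B₂ B₃ B₄) = [B₁, B₂, -B₃, -B₄] := rfl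

omit [NormedAlgebra 𝕜 𝔸] in
/-- the signed boundary sum = the lattice CURL `a + b − c − d` (B9 p. 391: `(DA)(p_{μν}(x)) = (D_μA_ν)(x) − (D_νA_μ)(x)` at `U = 1`).
[folklore] -/
theorem sum_four_signed (a b c d : 𝔸) : [a, b, -c, -d].sum = a + b - c - d := by
  simp only [List.sum_cons, List.sum_nil, add_zero, sub_eq_add_neg, add_assoc]

omit [NormedAlgebra 𝕜 𝔸] in
/-- THE TRANSPORT (TWIST) SUM OF THE PLAQUETTE WORD: the three later fluctuation letters commuted with the background
accumulated before them along the contour (`β₁ = 0`, `β₂ = B₁`, `β₃ = B₁ + B₂ − B₃`, `β₄ = B₁ + B₂ − B₃ − B₄`). [folklore] -/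
theorem twist_plaq : twistAux 0 (plaq W₁ W₂ W₃ W₄ B₁ B₂ B₃ B₄) =
    (B₁ * W₂ - W₂ * B₁) - ((B₁ + B₂ - B₃) * W₃ - W₃ * (B₁ + B₂ - B₃))
      - ((B₁ + B₂ - B₃ - B₄) * W₄ - W₄ * (B₁ + B₂ - B₃ - B₄)) := by
  simp only [plaq, twistAux_consW, twistAux_consB, twistAux_nil]
  noncomm_ring

omit [NormedAlgebra 𝕜 𝔸] in
/-- THE INVERSE WORD IS THE PLAQUETTE WITH REVERSED ORIENTATION (`U(−∂p) = U(∂p)⁻¹`, B9 p. 391). [folklore] -/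
theorem inv_plaq : inv (plaq W₁ W₂ W₃ W₄ B₁ B₂ B₃ B₄) = plaq W₄ W₃ W₂ W₁ B₄ B₃ B₂ B₁ := by
  simp [inv, plaq]

omit [NormedAlgebra 𝕜 𝔸] in
/-- **LINK TO `Beta.SpinTable` §6.**  The ordered commutator sum of the plaquette's fluctuation letters IS `SpinTable.plaqPairs`
(B9 (3.10)'s `Σ_{b₁≺b₂⊂∂p} [A′(b₁), A′(b₂)]` with the oriented boundary fields `(X, Y′, −X′, −Y) = (W₁, W₂, −W₃, −W₄)`). [folklore] -/
theorem commSum_wpart_plaq : commSum [W₁, W₂, -W₃, -W₄] = SpinTable.plaqPairs W₁ W₄ W₃ W₂ := by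
  simp only [commSum_cons, commSum_nil, List.sum_cons, List.sum_nil, SpinTable.plaqPairs, SpinTable.br]
  noncomm_ring

/-- **THE `(2,1)`-JET OF `tr U(∂p)`** (two fluctuation letters, one background letter), for every tracial linear `τ`:
`½τ(curl W · curl W · curl B)` (SYMMETRIC CUBIC) `+ ½τ(curl B · plaqPairs)` (SPIN: B9 (3.10)'s explicit term, coefficient ½ —
cf. the NOTE on (3.6) in `Beta.TransportVertices`) `+ τ(curl W · twist)` (TRANSPORT: the background-covariantisation of the
curl, the `B`-linear part of B9 (3.7)'s `tr((D_{U₀}A)(p))²`).  Exact, BCH-free, every ring. [folklore] -/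
theorem trace_P21_plaq (τ : 𝔸 →ₗ[𝕜] V) (hτ : ∀ a b : 𝔸, τ (a * b) = τ (b * a)) :
    τ (P21 𝕜 (plaq W₁ W₂ W₃ W₄ B₁ B₂ B₃ B₄)) =
      (2 : 𝕜)⁻¹ • τ ((W₁ + W₂ - W₃ - W₄) * ((W₁ + W₂ - W₃ - W₄) * (B₁ + B₂ - B₃ - B₄)))
        + (2 : 𝕜)⁻¹ • τ ((B₁ + B₂ - B₃ - B₄) * SpinTable.plaqPairs W₁ W₄ W₃ W₂)
        + τ ((W₁ + W₂ - W₃ - W₄) * ((B₁ * W₂ - W₂ * B₁) - ((B₁ + B₂ - B₃) * W₃ - W₃ * (B₁ + B₂ - B₃))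
            - ((B₁ + B₂ - B₃ - B₄) * W₄ - W₄ * (B₁ + B₂ - B₃ - B₄)))) := by
  rw [trace_P21 𝕜 τ hτ, wpart_plaq, bpart_plaq, sum_four_signed, sum_four_signed, commSum_wpart_plaq, twist_plaq]

/-- **THE `(2,1)`-JET OF `2·Re tr U(∂p) = tr U(∂p) + tr U(−∂p)`** (Bałaban's complexified real part, B9 p. 391): the symmetric
cubic CANCELS; what is left is SPIN `τ(curl B · plaqPairs)` + TRANSPORT `2τ(curl W · twist)`.  This is the exact
`(W², B¹)` vertex of the plaquette term `1 − Re tr U(∂p)` of the Wilson action (3.1) (up to the overall sign and the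
normalisation of `tr`), i.e. the `B`-linear part of the fine Hessian `½⟨A, Δ^η(U₀)A⟩` of (3.7)/(3.12) restricted to one
plaquette. [folklore] -/
theorem trace_P21_plaq_add_rev (τ : 𝔸 →ₗ[𝕜] V) (hτ : ∀ a b : 𝔸, τ (a * b) = τ (b * a)) :
    τ (P21 𝕜 (plaq W₁ W₂ W₃ W₄ B₁ B₂ B₃ B₄)) + τ (P21 𝕜 (plaq W₄ W₃ W₂ W₁ B₄ B₃ B₂ B₁)) =
      τ ((B₁ + B₂ - B₃ - B₄) * SpinTable.plaqPairs W₁ W₄ W₃ W₂)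
        + (2 : 𝕜) • τ ((W₁ + W₂ - W₃ - W₄) * ((B₁ * W₂ - W₂ * B₁) - ((B₁ + B₂ - B₃) * W₃ - W₃ * (B₁ + B₂ - B₃))
            - ((B₁ + B₂ - B₃ - B₄) * W₄ - W₄ * (B₁ + B₂ - B₃ - B₄)))) := by
  have h := trace_P21_add_trace_P21_inv 𝕜 τ hτ (plaq W₁ W₂ W₃ W₄ B₁ B₂ B₃ B₄)
  rw [inv_plaq] at h
  rw [h, wpart_plaq, bpart_plaq, sum_four_signed, sum_four_signed, commSum_wpart_plaq, twist_plaq]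

/-- **AT A CONSTANT FLUCTUATION FIELD** (`W_μ(x+e_ν) = W_μ(x) = X`, `W_ν(x+e_μ) = W_ν(x) = Y`) the curl of `W` vanishes, the
TRANSPORT term drops, and the `(2,1)`-jet of `tr U(∂p) + tr U(−∂p)` is `2·τ(curl B · [X, Y])` (`SpinTable.plaqPairs_local`): ONE
commutator `[W_μ, W_ν]` against the background plaquette field with coefficient ONE in `Re tr U(∂p)` — the spin-coupling unit
that `Beta.SpinTable` carried as the LABEL «one unit is (3.10)'s explicit term», here DERIVED from the group product. [folklore] -/
theorem trace_P21_plaq_add_rev_const (τ : 𝔸 →ₗ[𝕜] V) (hτ : ∀ a b : 𝔸, τ (a * b) = τ (b * a)) (X Y : 𝔸) :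
    τ (P21 𝕜 (plaq X Y X Y B₁ B₂ B₃ B₄)) + τ (P21 𝕜 (plaq Y X Y X B₄ B₃ B₂ B₁)) =
      (2 : 𝕜) • τ ((B₁ + B₂ - B₃ - B₄) * (X * Y - Y * X)) := by
  rw [trace_P21_plaq_add_rev 𝕜 X Y X Y B₁ B₂ B₃ B₄ τ hτ, SpinTable.plaqPairs_local, SpinTable.br]
  have h0 : X + Y - X - Y = 0 := by abel
  rw [h0, zero_mul, map_zero, smul_zero, add_zero, two_smul, ← map_add, ← mul_add, two_mul]

end Plaquette

/-! ## §5 Identification: `cubic` is one sixth of the third derivative of the transport path -/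

section Calculus

variable (𝕜 : Type*) [RCLike 𝕜] {𝔸 : Type*} [NormedRing 𝔸] [NormedAlgebra 𝕜 𝔸] [CompleteSpace 𝔸]

/-- Third derivative of the transport path `t ↦ Π_j exp(t b_j)` (recursive Leibniz form, continuing `D₁`, `D₂` of
`Beta.TransportVertices`). [folklore] -/
def D₃ : List 𝔸 → 𝕜 → 𝔸
  | [], _ => 0
  | b :: l, t => b * (b * (b * exp (t • b))) * holPath 𝕜 l t
      + (b * (b * exp (t • b)) * D₁ 𝕜 l t + b * (b * exp (t • b)) * D₁ 𝕜 l t + b * (b * exp (t • b)) * D₁ 𝕜 l t)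
      + (b * exp (t • b) * D₂ 𝕜 l t + b * exp (t • b) * D₂ 𝕜 l t + b * exp (t • b) * D₂ 𝕜 l t)
      + exp (t • b) * D₃ l t

/-- `D₂ l` is differentiable with derivative `D₃ l t`. [folklore] -/
theorem hasDerivAt_D₂ (l : List 𝔸) (t : 𝕜) : HasDerivAt (D₂ 𝕜 l) (D₃ 𝕜 l t) t := by
  induction l with
  | nil =>
    have h : D₂ 𝕜 ([] : List 𝔸) = fun _ => 0 := by funext u; simp [D₂]
    rw [h]
    simpa [D₃] using hasDerivAt_const t (0 : 𝔸)
  | cons b l ih =>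
    have hD : D₂ 𝕜 (b :: l) = fun u =>
        b * (b * exp (u • b)) * holPath 𝕜 l u + (b * exp (u • b) * D₁ 𝕜 l u + b * exp (u • b) * D₁ 𝕜 l u)
          + exp (u • b) * D₂ 𝕜 l u := by
      funext u; simp [D₂, two_smul]
    rw [hD]
    have hE : HasDerivAt (fun u : 𝕜 => exp (u • b)) (b * exp (t • b)) t := hasDerivAt_exp_smul_const' b t
    have h1 : HasDerivAt (fun u : 𝕜 => b * exp (u • b)) (b * (b * exp (t • b))) t := hE.const_mul b
    have h2 : HasDerivAt (fun u : 𝕜 => b * (b * exp (u • b))) (b * (b * (b * exp (t • b)))) t := h1.const_mul b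
    have h := ((h2.mul (hasDerivAt_holPath 𝕜 l t)).add
      ((h1.mul (hasDerivAt_D₁ 𝕜 l t)).add (h1.mul (hasDerivAt_D₁ 𝕜 l t)))).add (hE.mul ih)
    refine h.congr_deriv ?_
    simp only [D₃]
    noncomm_ring

omit [CompleteSpace 𝔸] in
/-- **THIRD VARIATION AT ZERO BACKGROUND: `(d³/dt³)|₀ Π_j exp(t b_j) = 6 · cubic [b₁,…,b_n]`** — `cubic` IS the third-order
Taylor term of the ordered product of exponentials (with `cubic_map_scale`: `P21` is the `σ²τ`-coefficient of the third
derivative along the ray `(σW, τB)`, i.e. the `(2,1)` Taylor coefficient). [folklore] -/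
theorem D₃_zero (l : List 𝔸) : D₃ 𝕜 l 0 = (6 : 𝕜) • cubic 𝕜 l := by
  induction l with
  | nil => simp [D₃]
  | cons b l ih =>
    have h2 : D₂ 𝕜 l 0 = (2 : 𝕜) • quad 𝕜 l := D₂_zero_eq_two_smul_quad 𝕜 l
    simp only [D₃, zero_smul, exp_zero, holPath_zero, D₁_zero, h2, ih, cubic_cons, mul_one, one_mul, smul_add,
      mul_smul_comm, smul_mul_assoc, smul_smul, mul_assoc]
    rw [show (6 : 𝕜) * (2 : 𝕜)⁻¹ = 3 by norm_num, show (6 : 𝕜) * (6 : 𝕜)⁻¹ = 1 by norm_num, one_smul]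
    module

/-- the third-order summary at zero background: `HasDerivAt (D₂ l) (6 · cubic l) 0`. [folklore] -/
theorem hasDerivAt_D₂_zero (l : List 𝔸) : HasDerivAt (D₂ 𝕜 l) ((6 : 𝕜) • cubic 𝕜 l) 0 := by
  simpa [D₃_zero] using hasDerivAt_D₂ 𝕜 l 0

end Calculus

/-! ## §6 Colour: the commutator traces are the adjoint-action matrices of `Beta.ColourTrace` -/

section Colour

open ColourTrace

/-- **THE COLOUR TENSOR OF BOTH VERTICES.**  With anti-Hermitian letters `i·τ_a` built from a generator family `τ` (Bałaban's
`U = exp(iηA)`, `A = Σ_a A^a τ_a`), the elementary trace `Tr(iτ_a · [iτ_b, iτ_c])` occurring in the TRANSPORT term (`a` ↔ curl W,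
`b` ↔ accumulated background, `c` ↔ the later fluctuation letter) and in the SPIN term (`a` ↔ curl B, `b, c` ↔ the ordered pair)
is `−N · adMatC τ (τ_b) a c` — the ADJOINT-ACTION («twist») matrix of the middle letter sandwiched between the outer two, the
colour object `Beta.GhostTable`/`Beta.SpinTable` consume (`ColourTrace.trace_adMatC_gen`: its trace form is `−2N²δ`).
[folklore] -/
theorem trace_gen_bracket {N : ℕ} {C : Type*} [Fintype C] (hN : N ≠ 0) (τ : C → Matrix (Fin N) (Fin N) ℂ)
    (a b c : C) :
    Matrix.trace ((Complex.I • τ a) * ((Complex.I • τ b) * (Complex.I • τ c) - (Complex.I • τ c) * (Complex.I • τ b)))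
      = -(N : ℂ) * adMatC τ (τ b) a c := by
  have hN' : (N : ℂ) ≠ 0 := Nat.cast_ne_zero.mpr hN
  rw [adMatC, Matrix.of_apply, ntr, ibr]
  simp only [Matrix.smul_mul, Matrix.mul_smul, smul_sub, Matrix.mul_sub, Matrix.trace_smul, Matrix.trace_sub,
    smul_eq_mul]
  field_simp
  rw [Complex.I_sq, neg_one_mul]

end Colour

/-! ## Examples -/

section Examples

variable {𝔸 : Type*} [NormedRing 𝔸] [NormedAlgebra ℝ 𝔸]

/-- Two letters, fluctuation first: the `(2,1)`-component of `e^x e^y` is `½x²·y`. [folklore] -/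
example (x y : 𝔸) : P21 ℝ [(true, x), (false, y)] = (2 : ℝ)⁻¹ • (x * x) * y := by
  simp [P21, P11]

/-- Two letters, background first: the `(2,1)`-component of `e^y e^x` is `y·½x²`. [folklore] -/
example (x y : 𝔸) : P21 ℝ [(false, y), (true, x)] = y * ((2 : ℝ)⁻¹ • (x * x)) := by
  simp [P21, quad_cons]

/-- The transport sum of `e^y e^x` is the one commutator `[y, x]`; of `e^x e^y` it is zero. [folklore] -/
example (x y : 𝔸) : twistAux 0 [(false, y), (true, x)] = y * x - x * y ∧ twistAux 0 [(true, x), (false, y)] = 0 := by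
  constructor <;> simp

/-- The inverse of the plaquette word read backwards is the plaquette again. [folklore] -/
example (W₁ W₂ W₃ W₄ B₁ B₂ B₃ B₄ : 𝔸) : inv (inv (plaq W₁ W₂ W₃ W₄ B₁ B₂ B₃ B₄)) = plaq W₁ W₂ W₃ W₄ B₁ B₂ B₃ B₄ := by
  rw [inv_plaq, inv_plaq]

end Examples

end Literature.MathematicalPhysics.QuantumFieldTheory.Balaban1983to89.Beta.WilsonVertex
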